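import Literature.MathematicalPhysics.QuantumFieldTheory.Balaban1983to89.B2Eq224FirstStepFields

/-!
# `Balaban1983to89.B2Eq287Translation` — [Balaban1982Higgs2] (2.80)/(2.87) p. 574–575: the result of the k-th step
translation `A = A′ + aL⁻²C^{(k)}_{Λ₀^{(k)}}Q*B` (2.80) on the quadratic form in the vector fields `B, A` under the integral
(2.53) — the identity (2.87) PROVED EXACTLY, as the localized (`Λ₆^{(k−1)′}`) twin of r02's first-step identity
`B2Eq224FirstStepFields.eq226_quadratic` ((2.26) p. 562)

statement-level skeleton of published theorems with citation tags; proofs where landed; nothing here is a claim about the Yang–Mills mass gap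

PDF held: `paper:balaban1982-cmp86-higgs23-ii` (T. Bałaban, *(Higgs)₂,₃ quantum fields in a finite volume. II. An upper
bound*, Commun. Math. Phys. **86** (1982) 555–594, doi 10.1007/bf01214890; journal page = PDF page + 554); pp. 574–575
[PDF 20–21] READ AS IMAGES on the ×2 renders
`run/shared/lean/pub/pub-balaban/b2b-balaban-ref1/pages/1982-cmp86-higgs23-II/1982-cmp86-higgs23-II-p020-x2.png`,
`…-p021-x2.png`; p. 562 [PDF 8] for (2.26)–(2.27).

CITATION HEADER — WHAT IS REPRODUCED.  Display **(2.87) p. 575** (with (2.80) p. 574), which has NO SKELETON row today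
(the B2 rows jump from B2.Eq2.86 ((2.86)) to B2.Eq2.103 ((2.99)–(2.107)); the fold owner r02 / reader r14 are asked to
host it — e.g. as a member of B2.Eq2.86's neighbourhood or a new row B2.Eq2.87); it is the k-th step twin of the
quadratic lines of (2.26) (row B2.Eq2.42, `eq226_quadratic` r02 p248319) and feeds (2.88)–(2.91), (2.99)–(2.115).  Unit
`lit-balaban-p15` gen 5 (Phase-2 proof seat p15; HOME `run/shared/lean/pub/lit-balaban/`, seat dir `lit-balaban-p15/`);
B2 fold owner r02, second reader r14; referee ref-4.  Inputs BY NAME (r02, `B2Eq224FirstStepFields` p248319 /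
`B2Eq218Translation` p246645): `transl223` (the translation shape (2.18)/(2.23)/(2.80)), `gaussForm` (the one-pair
Gaussian exponent), `kOp` (`aL⁻²Q*Q + Δ^{(k)}` of (I.2.31)), `delta227` (`Δ^{(k+1),L}_Λ` of (2.27)), `bdry226`,
**`eq226_quadratic`** (the whole-field identity), `covΛ_mulVec_eq_zero`, `dot_mulVec_comm`, `restrict`.

WHAT IS PRINTED (pp. 574–575 [PDF 20–21], verbatim).  *"The next operation is a translation in the vector fields and an
expansion of the action with respect to a proper small field. We make the translation A = A′ + aL⁻²C^{(k)}_{Λ₀^{(k)}}Q*B.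
(2.80) … Now let us investigate a result of the translation (2.80) in the integral (2.53). For the quadratic form in the
fields B, A standing in the exponential function under the integral, we have
½aL^{d−2}Σ_{y∈T₁^{(k)′}}|B(y) − (QA)(y)|² + ½⟨Λ₆^{(k−1)′}A, Δ^{(k)}Λ₆^{(k−1)′}A⟩
 = ½aL^{d−2}Σ_{y∈T₁^{(k)′}}|(Λ₀^{(k)′c}B)(y) − (QA′)(y)|² + ½⟨Λ₆^{(k−1)′}A′, Δ^{(k)}Λ₆^{(k−1)′}A′⟩
 + aL⁻²⟨(Λ₆^{(k−1)′}∩Λ₀^{(k)c})A′, Δ^{(k)}C^{(k)}_{Λ₀^{(k)}}Q*B⟩ + ½⟨B, Δ^{(k+1),L}_{Λ₀^{(k)′}}B⟩.  (2.87)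
It is easily seen that the quadratic form in the field A′ restricted e.g. to the set Λ₅^{(k)} has the form
½⟨Λ₅^{(k)}A′, (C^{(k)}_{Λ₅^{(k)}})⁻¹Λ₅^{(k)}A′⟩."*  With (2.27) p. 562: *"⟨ψ, Δ^{(k+1),L}_Λ(Ω, A)ψ⟩ = aL^{d−2}Σ_{y∈Λ′}|ψ(y)|² −
a²L⁻⁴⟨ψ, Q(A)C^{(k)}_Λ(Ω, A)Q*(A)ψ⟩"* and (I.2.32) p. 611 (C^{(k)}_Λ = the inverse of `aL⁻²P + Δ^{(k)}` compressed to Λ).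

THE ARGUMENT (the print: none; the evident one).  Write `φ₀ = aL⁻²C_{Λ₀}Q*B` (supported in `Λ₀ ⊆ Λ₆`), `s = Λ₆ᶜA′`
(`= Λ₆ᶜA`).  Then `Λ₆A = Λ₆A′ + φ₀` and, `Δ^{(k)}` being symmetric,
`½⟨A,Δ A⟩ − ½⟨Λ₆A, ΔΛ₆A⟩ = [½⟨A′,ΔA′⟩ − ½⟨Λ₆A′,ΔΛ₆A′⟩] + ⟨Λ₆ᶜA′, Δφ₀⟩`; so (2.87) is the WHOLE-FIELD identity (2.26)
(`eq226_quadratic`: `½aL^{d−2}Σ|B − QA|² + ½⟨A,ΔA⟩ = ½aL^{d−2}Σ|Λ₀′ᶜB − QA′|² + ½⟨A′,ΔA′⟩ + aL⁻²⟨Λ₀ᶜA′, ΔC_{Λ₀}Q*B⟩ +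
½⟨B,Δ^{(k+1),L}_{Λ₀′}B⟩`, the boundary sum `bdry226` being `−aL⁻²⟨Λ₀ᶜA′, ΔC_{Λ₀}Q*B⟩`) minus that bracket, and
`aL⁻²⟨Λ₀ᶜA′, ΔC_{Λ₀}Q*B⟩ − aL⁻²⟨Λ₆ᶜA′, ΔC_{Λ₀}Q*B⟩ = aL⁻²⟨(Λ₆∖Λ₀)A′, ΔC_{Λ₀}Q*B⟩` — exactly the printed cross term over
`Λ₆^{(k−1)′} ∩ Λ₀^{(k)c}` (the infinite-range tails of `Δ^{(k)}` off `Λ₆^{(k−1)′}` CANCEL; no error term).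

DICTIONARY = r02's (plain real coordinates): `X` ↤ components of the unit-lattice (`T₁^{(k)}`) vector fields, `Y` ↤
components of the block (`L`-lattice, `T₁^{(k)′}`) fields; `Q : Matrix Y X ℝ` ↤ `Q`, `Qs = w•Qᵀ` ↤ `Q*` (`w` ↤ `L^d`, the
weight of `⟨·,·⟩_{T₁^{(k)′}}`; the unit-lattice pairing has weight 1); `c` ↤ `aL⁻²` (`c·w = aL^{d−2}`); `D : Matrix X X ℝ`
symmetric ↤ `Δ^{(k)} = Δ^{(k),Lᵏε}(…)` of (2.46)/(I.2.21) on the unit lattice; `Λ : Finset X` ↤ `Λ₀^{(k)}` with block set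
`Λ' : Finset Y` ↤ `Λ₀^{(k)′}` (`hQ`: *"union of big blocks"*); `CΛ` ↤ `C^{(k)}_{Λ₀^{(k)}}` extended by zero (`hCs`) and
inverting `kOp c Q Qs D = aL⁻²Q*Q + Δ^{(k)}` on `Λ` (`hC`, (I.2.32)); `Λ₆ : Finset X` ↤ `Λ₆^{(k−1)′}` — a set of points of the
unit lattice `T₁^{(k)}` (the (k−1)-st step's primed sets live on that step's L-lattice = this step's unit lattice) with
`Λ₀^{(k)} ⊆ Λ₆^{(k−1)′}` (`h06`, the nesting of the small-field regions of consecutive steps); `restrict S u` ↤ `Su`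
(indicator cut-off); `transl223 c CΛ Qs A' B` ↤ the translated field `A` of (2.80).

WHAT IS KERNEL-CHECKED (zero `sorry`, standard axioms, no definitions).  `transl280_eq_transl223` ((2.80) IS the shape
(2.23)/(2.18), definitional), `restrict_transl280` (`Λ₆A = Λ₆A′ + φ₀`), `sub_restrict_transl280` (`A − Λ₆A = Λ₆ᶜA′`),
`half_form_sub_half_form_restrict` (the symmetric-form bracket), `bdry226_eq_neg_dot` (`bdry226 = −aL⁻²⟨Λ₀ᶜA′, ΔC_{Λ₀}Q*B⟩`),
`restrict_compl_sub_restrict_compl`, **`eq287`** ((2.87) EXACTLY), `eq287_gaussForm` (the same with r02's `gaussForm` on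
the left: `gaussForm c w Q D A B − ½⟨A,ΔA⟩ + ½⟨Λ₆A,ΔΛ₆A⟩ = …`).
HONEST SCOPE.  As in r02's (2.26) file: operators are data with the printed structural facts as hypotheses
(`Q* = L^dQᵀ`, block structure, `Δ^{(k)}` symmetric, (I.2.32)); nothing about the integral (2.53) or the measure is
asserted; the sentence after (2.87) (the form `½⟨Λ₅A′, (C_{Λ₅})⁻¹Λ₅A′⟩`) is not formalised here.
-/

namespace Literature.MathematicalPhysics.QuantumFieldTheory.Balaban1983to89.B2Eq287Translation

open Matrix
open B2Eq218Translation (restrict)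
open B2Eq224FirstStepFields (transl223 gaussForm kOp delta227 bdry226 eq226_quadratic covΛ_mulVec_eq_zero
  dot_mulVec_comm)

variable {X Y : Type*} [Fintype X] [Fintype Y] [DecidableEq X] [DecidableEq Y]

omit [DecidableEq X] [DecidableEq Y] in
/-- **(2.80)** p. 574 [PDF 20], verbatim: *"A = A′ + aL⁻²C^{(k)}_{Λ₀^{(k)}}Q*B"* — the same shape as (2.18)/(2.23) (and
(2.110)): r02's `transl223 c CΛ Qs A′ B = A′ + aL⁻²·C^{(k)}_{Λ₀}(Q*B)` with `CΛ` ↤ `C^{(k)}_{Λ₀^{(k)}}`. KERNEL (definitional).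
[cite: Balaban1982Higgs2, (2.80) p.574] -/
theorem transl280_eq_transl223 (c : ℝ) (CΛ : Matrix X X ℝ) (Qs : Matrix X Y ℝ) (A' : X → ℝ) (B : Y → ℝ) :
    transl223 c CΛ Qs A' B = A' + c • (CΛ *ᵥ (Qs *ᵥ B)) := rfl

omit [DecidableEq Y] in
/-- `Λ₆A = Λ₆A′ + aL⁻²C_{Λ₀}Q*B`: the translation term is supported in `Λ₀ ⊆ Λ₆` (Dirichlet support `hCs`, nesting `h06`).
[cite: Balaban1982Higgs2, (2.80) p.574] -/
theorem restrict_transl280 {c : ℝ} {Λ Λ₆ : Finset X} {CΛ : Matrix X X ℝ} {Qs : Matrix X Y ℝ}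
    (hCs : ∀ x x', CΛ x x' ≠ 0 → x ∈ Λ ∧ x' ∈ Λ) (h06 : Λ ⊆ Λ₆) (A' : X → ℝ) (B : Y → ℝ) :
    restrict Λ₆ (transl223 c CΛ Qs A' B) = restrict Λ₆ A' + c • (CΛ *ᵥ (Qs *ᵥ B)) := by
  funext x
  simp only [restrict, transl223, Pi.add_apply, Pi.smul_apply, smul_eq_mul]
  by_cases hx : x ∈ Λ₆
  · simp [hx]
  · have hxΛ : x ∉ Λ := fun h => hx (h06 h)
    simp [hx, covΛ_mulVec_eq_zero hCs hxΛ]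

omit [DecidableEq Y] in
/-- `A − Λ₆A = Λ₆ᶜA′` for the translated field (the translation term lives inside `Λ₆`).
[cite: Balaban1982Higgs2, (2.80) p.574] -/
theorem sub_restrict_transl280 {c : ℝ} {Λ Λ₆ : Finset X} {CΛ : Matrix X X ℝ} {Qs : Matrix X Y ℝ}
    (hCs : ∀ x x', CΛ x x' ≠ 0 → x ∈ Λ ∧ x' ∈ Λ) (h06 : Λ ⊆ Λ₆) (A' : X → ℝ) (B : Y → ℝ) :
    transl223 c CΛ Qs A' B - restrict Λ₆ (transl223 c CΛ Qs A' B) = restrict Λ₆ᶜ A' := by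
  rw [restrict_transl280 hCs h06]
  funext x
  simp only [transl223, restrict, Pi.sub_apply, Pi.add_apply, Pi.smul_apply, smul_eq_mul, Finset.mem_compl]
  by_cases hx : x ∈ Λ₆
  · simp [hx]
  · have hxΛ : x ∉ Λ := fun h => hx (h06 h)
    simp [hx, covΛ_mulVec_eq_zero hCs hxΛ]

omit [Fintype Y] [DecidableEq X] [DecidableEq Y] in
/-- The symmetric-form bracket: for `Δ` symmetric and `A = u + s`, `½⟨A,ΔA⟩ − ½⟨u,Δu⟩ = ⟨s,Δu⟩ + ½⟨s,Δs⟩`.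
[folklore] [cite: Balaban1982Higgs2, (2.87) p.575] -/
theorem half_form_sub_half_form_restrict {D : Matrix X X ℝ} (hD : Dᵀ = D) (u s : X → ℝ) :
    1 / 2 * ((u + s) ⬝ᵥ (D *ᵥ (u + s))) - 1 / 2 * (u ⬝ᵥ (D *ᵥ u))
      = s ⬝ᵥ (D *ᵥ u) + 1 / 2 * (s ⬝ᵥ (D *ᵥ s)) := by
  rw [Matrix.mulVec_add, add_dotProduct, dotProduct_add, dotProduct_add, dot_mulVec_comm hD u s]
  ring

omit [DecidableEq Y] in
/-- The boundary sum of (2.26)/(2.87) as a pairing: `bdry226 = −aL⁻²⟨Λ₀ᶜA′, Δ^{(k)}C_{Λ₀}Q*B⟩` (the conditioned covariance is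
supported in `Λ₀`, so the inner sum over `Λ₀` is the full `Δ^{(k)}`-image). [cite: Balaban1982Higgs2, (2.87) p.575] -/
theorem bdry226_eq_neg_dot {c : ℝ} {Λ : Finset X} {D CΛ : Matrix X X ℝ} {Qs : Matrix X Y ℝ}
    (hCs : ∀ x x', CΛ x x' ≠ 0 → x ∈ Λ ∧ x' ∈ Λ) (A' : X → ℝ) (B : Y → ℝ) :
    bdry226 c Λ D CΛ Qs A' B = -(c * (restrict Λᶜ A' ⬝ᵥ (D *ᵥ (CΛ *ᵥ (Qs *ᵥ B))))) := by
  unfold bdry226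
  have hinner : ∀ x, ∑ x' ∈ Λ, A' x * (-D x x') * (CΛ *ᵥ (Qs *ᵥ B)) x'
      = -(A' x * (D *ᵥ (CΛ *ᵥ (Qs *ᵥ B))) x) := by
    intro x
    have hfull : ∑ x' ∈ Λ, A' x * (-D x x') * (CΛ *ᵥ (Qs *ᵥ B)) x'
        = ∑ x', A' x * (-D x x') * (CΛ *ᵥ (Qs *ᵥ B)) x' := by
      refine (Finset.sum_subset (Finset.subset_univ Λ) fun x' _ hx' => ?_)
      rw [covΛ_mulVec_eq_zero hCs hx', mul_zero]
    rw [hfull]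
    change _ = -(A' x * ∑ x', D x x' * (CΛ *ᵥ (Qs *ᵥ B)) x')
    rw [Finset.mul_sum, ← Finset.sum_neg_distrib]
    exact Finset.sum_congr rfl fun x' _ => by ring
  rw [Finset.sum_congr rfl fun x _ => hinner x]
  have hdot : restrict Λᶜ A' ⬝ᵥ (D *ᵥ (CΛ *ᵥ (Qs *ᵥ B)))
      = ∑ x ∈ Λᶜ, A' x * (D *ᵥ (CΛ *ᵥ (Qs *ᵥ B))) x := by
    unfold dotProduct
    rw [← Finset.sum_subset (Finset.subset_univ Λᶜ)]
    · refine Finset.sum_congr rfl fun x hx => ?_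
      rw [show restrict Λᶜ A' x = A' x from if_pos hx]
    · intro x _ hx
      rw [show restrict Λᶜ A' x = 0 from if_neg hx, zero_mul]
  rw [hdot, Finset.sum_neg_distrib, mul_neg]

omit [Fintype Y] [DecidableEq Y] in
/-- `Λ₀ᶜA′ − Λ₆ᶜA′ = (Λ₆∖Λ₀)A′` for `Λ₀ ⊆ Λ₆`. [folklore] [cite: Balaban1982Higgs2, (2.87) p.575] -/
theorem restrict_compl_sub_restrict_compl {Λ Λ₆ : Finset X} (h06 : Λ ⊆ Λ₆) (A' : X → ℝ) :
    restrict Λᶜ A' - restrict Λ₆ᶜ A' = restrict (Λ₆ \ Λ) A' := by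
  funext x
  simp only [restrict, Pi.sub_apply, Finset.mem_compl, Finset.mem_sdiff]
  by_cases hx6 : x ∈ Λ₆
  · by_cases hx : x ∈ Λ <;> simp [hx, hx6]
  · have hx : x ∉ Λ := fun h => hx6 (h06 h)
    simp [hx, hx6]

/-- **(2.87) p. 575, PROVED EXACTLY**: for `Q* = L^dQᵀ` (`hQs`), `Λ₀` a union of big blocks with block set `Λ₀′` (`hQ`),
`Δ^{(k)}` symmetric (`hD`), `C^{(k)}_{Λ₀} = ((aL⁻²Q*Q + Δ^{(k)})↾_{Λ₀})⁻¹` extended by zero (`hCs`, `hC`), `Λ₀^{(k)} ⊆ Λ₆^{(k−1)′}`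
(`h06`), the translation `A = A′ + aL⁻²C^{(k)}_{Λ₀}Q*B` (2.80) gives
`½aL^{d−2}Σ_y|B(y) − (QA)(y)|² + ½⟨Λ₆A, Δ^{(k)}Λ₆A⟩ = ½aL^{d−2}Σ_y|(Λ₀′ᶜB)(y) − (QA′)(y)|² + ½⟨Λ₆A′, Δ^{(k)}Λ₆A′⟩ +
aL⁻²⟨(Λ₆∖Λ₀)A′, Δ^{(k)}C^{(k)}_{Λ₀}Q*B⟩ + ½⟨B, Δ^{(k+1),L}_{Λ₀′}B⟩` with `Δ^{(k+1),L}_{Λ₀′}` the operator (2.27) (`delta227`;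
block pairing of weight `w = L^d`). [cite: Balaban1982Higgs2, (2.87) p.575] -/
theorem eq287 {c w : ℝ} {Λ Λ₆ : Finset X} {Λ' : Finset Y} {Q : Matrix Y X ℝ} {Qs : Matrix X Y ℝ} {D CΛ : Matrix X X ℝ}
    (hQs : Qs = w • Qᵀ) (hQ : ∀ y x, Q y x ≠ 0 → (x ∈ Λ ↔ y ∈ Λ')) (hD : Dᵀ = D)
    (hCs : ∀ x x', CΛ x x' ≠ 0 → x ∈ Λ ∧ x' ∈ Λ)
    (hC : ∀ x ∈ Λ, ∀ x' ∈ Λ, ∑ z, kOp c Q Qs D x z * CΛ z x' = if x = x' then 1 else 0)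
    (h06 : Λ ⊆ Λ₆) (A' : X → ℝ) (B : Y → ℝ) :
    1 / 2 * (c * w) * ∑ y, (B y - (Q *ᵥ transl223 c CΛ Qs A' B) y) ^ 2
        + 1 / 2 * (restrict Λ₆ (transl223 c CΛ Qs A' B) ⬝ᵥ (D *ᵥ restrict Λ₆ (transl223 c CΛ Qs A' B)))
      = 1 / 2 * (c * w) * ∑ y, ((B - restrict Λ' B) y - (Q *ᵥ A') y) ^ 2
        + 1 / 2 * (restrict Λ₆ A' ⬝ᵥ (D *ᵥ restrict Λ₆ A'))
        + c * (restrict (Λ₆ \ Λ) A' ⬝ᵥ (D *ᵥ (CΛ *ᵥ (Qs *ᵥ B))))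
        + 1 / 2 * (w * (B ⬝ᵥ (delta227 c Λ' Q CΛ Qs *ᵥ B))) := by
  -- the whole-field identity (2.26)
  have h226 := eq226_quadratic hQs hQ hD hCs hC A' B
  unfold gaussForm at h226
  -- names
  set A := transl223 c CΛ Qs A' B with hA
  set φ₀ : X → ℝ := c • (CΛ *ᵥ (Qs *ᵥ B)) with hφ₀
  set s : X → ℝ := restrict Λ₆ᶜ A' with hs
  -- `A = Λ₆A + s`, `A′ = Λ₆A′ + s`, `Λ₆A = Λ₆A′ + φ₀`
  have hAs : A = restrict Λ₆ A + s := by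
    rw [hs, ← sub_restrict_transl280 hCs h06 A' B]
    abel
  have hA's : A' = restrict Λ₆ A' + s := by
    funext x
    simp only [hs, restrict, Pi.add_apply, Finset.mem_compl]
    by_cases hx : x ∈ Λ₆ <;> simp [hx]
  have hr : restrict Λ₆ A = restrict Λ₆ A' + φ₀ := restrict_transl280 hCs h06 A' B
  -- the two brackets
  have hb1 : 1 / 2 * (A ⬝ᵥ (D *ᵥ A)) - 1 / 2 * (restrict Λ₆ A ⬝ᵥ (D *ᵥ restrict Λ₆ A))
      = s ⬝ᵥ (D *ᵥ restrict Λ₆ A) + 1 / 2 * (s ⬝ᵥ (D *ᵥ s)) := by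
    have h := half_form_sub_half_form_restrict hD (restrict Λ₆ A) s
    rw [← hAs] at h
    exact h
  have hb2 : 1 / 2 * (A' ⬝ᵥ (D *ᵥ A')) - 1 / 2 * (restrict Λ₆ A' ⬝ᵥ (D *ᵥ restrict Λ₆ A'))
      = s ⬝ᵥ (D *ᵥ restrict Λ₆ A') + 1 / 2 * (s ⬝ᵥ (D *ᵥ s)) := by
    have h := half_form_sub_half_form_restrict hD (restrict Λ₆ A') s
    rw [← hA's] at h
    exact h
  have hb3 : s ⬝ᵥ (D *ᵥ restrict Λ₆ A) = s ⬝ᵥ (D *ᵥ restrict Λ₆ A') + s ⬝ᵥ (D *ᵥ φ₀) := by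
    rw [hr, Matrix.mulVec_add, dotProduct_add]
  -- the boundary sum and the cross term
  have hbd : bdry226 c Λ D CΛ Qs A' B = -(c * (restrict Λᶜ A' ⬝ᵥ (D *ᵥ (CΛ *ᵥ (Qs *ᵥ B))))) :=
    bdry226_eq_neg_dot hCs A' B
  have hsφ : s ⬝ᵥ (D *ᵥ φ₀) = c * (restrict Λ₆ᶜ A' ⬝ᵥ (D *ᵥ (CΛ *ᵥ (Qs *ᵥ B)))) := by
    rw [hs, hφ₀, Matrix.mulVec_smul, dotProduct_smul, smul_eq_mul]
  have hcross : c * (restrict Λᶜ A' ⬝ᵥ (D *ᵥ (CΛ *ᵥ (Qs *ᵥ B))))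
      - c * (restrict Λ₆ᶜ A' ⬝ᵥ (D *ᵥ (CΛ *ᵥ (Qs *ᵥ B))))
      = c * (restrict (Λ₆ \ Λ) A' ⬝ᵥ (D *ᵥ (CΛ *ᵥ (Qs *ᵥ B)))) := by
    rw [← mul_sub, ← sub_dotProduct, restrict_compl_sub_restrict_compl h06]
  linear_combination h226 - hb1 + hb2 - hb3 - hbd - hsφ + hcross

/-- **(2.87) against r02's one-pair exponent**: `gaussForm c w Q Δ A B − ½⟨A, ΔA⟩ + ½⟨Λ₆A, ΔΛ₆A⟩` (the printed left side:
the block term of the renormalization kernel plus the Λ₆-LOCALIZED basic form, cf. (2.49)) equals the right side of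
(2.87). [cite: Balaban1982Higgs2, (2.87) p.575] -/
theorem eq287_gaussForm {c w : ℝ} {Λ Λ₆ : Finset X} {Λ' : Finset Y} {Q : Matrix Y X ℝ} {Qs : Matrix X Y ℝ}
    {D CΛ : Matrix X X ℝ} (hQs : Qs = w • Qᵀ) (hQ : ∀ y x, Q y x ≠ 0 → (x ∈ Λ ↔ y ∈ Λ')) (hD : Dᵀ = D)
    (hCs : ∀ x x', CΛ x x' ≠ 0 → x ∈ Λ ∧ x' ∈ Λ)
    (hC : ∀ x ∈ Λ, ∀ x' ∈ Λ, ∑ z, kOp c Q Qs D x z * CΛ z x' = if x = x' then 1 else 0)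
    (h06 : Λ ⊆ Λ₆) (A' : X → ℝ) (B : Y → ℝ) :
    gaussForm c w Q D (transl223 c CΛ Qs A' B) B
        - 1 / 2 * (transl223 c CΛ Qs A' B ⬝ᵥ (D *ᵥ transl223 c CΛ Qs A' B))
        + 1 / 2 * (restrict Λ₆ (transl223 c CΛ Qs A' B) ⬝ᵥ (D *ᵥ restrict Λ₆ (transl223 c CΛ Qs A' B)))
      = 1 / 2 * (c * w) * ∑ y, ((B - restrict Λ' B) y - (Q *ᵥ A') y) ^ 2
        + 1 / 2 * (restrict Λ₆ A' ⬝ᵥ (D *ᵥ restrict Λ₆ A'))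
        + c * (restrict (Λ₆ \ Λ) A' ⬝ᵥ (D *ᵥ (CΛ *ᵥ (Qs *ᵥ B))))
        + 1 / 2 * (w * (B ⬝ᵥ (delta227 c Λ' Q CΛ Qs *ᵥ B))) := by
  rw [← eq287 hQs hQ hD hCs hC h06 A' B]
  unfold gaussForm
  ring

end Literature.MathematicalPhysics.QuantumFieldTheory.Balaban1983to89.B2Eq287Translation
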